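/-
Copyright (c) 2026. All rights reserved.
Released under Apache 2.0 license as described in the file LICENSE.
-/
import Literature.NumberTheory.GaloisRepresentations.LabelledWeightsDet
import Mathlib.LinearAlgebra.Matrix.Kronecker
import HarnessLib

/-!
# Labelled Hodge–Tate weights of a Kronecker product: `HT_τ(r₁ ⊗ r₂) = HT_τ(r₁) + HT_τ(r₂)`

Let `𝔅` be a period-ring datum of `Γ` over `P` with invariant field `F` whose period ring `B` is a
field, `E/P` a finite extension containing the `[F:P]` embeddings of `F`, and
`r₁ : Γ → GL_n(E)`, `r₂ : Γ → GL_m(E)` framed representations with `B`-admissible `P`-restrictions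
satisfying the FILTERED COMPARISON (`hcomp`; for `B = B_dR` and de Rham `rᵢ` this is the accepted
`exists_basis_mem_filTensor_iff_of_isDeRham`).  Let `r : Γ → GL_k(E)` be their Kronecker product in
the product basis enumerated by `e : Fin n × Fin m ≃ Fin k` (`r(σ) = e_*(r₁(σ) ⊗ₖ r₂(σ))`).  Then for
every label `τ : F → E`

  **`HT_τ(r) = {a + b : a ∈ HT_τ(r₁), b ∈ HT_τ(r₂)}`** (with multiplicities)

(`PeriodRingData.labelledHodgeTateWeights_kron`) — the coefficient version of Fontaine's
`D_dR(V ⊗ W) = D_dR(V) ⊗_K D_dR(W)` as filtered modules (Fontaine, Exp. III §1.5; Brinon–Conrad §6.3;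
Patrikis 2019 §2.3.1: `D_dR` with coefficients is a `⊗`-functor of filtered `F ⊗ E`-modules).

## Proof

Inside the ring `Eᵏ ⊗_P B` the products `ι₁(x) · ι₂(y)` of `x ∈ D_τ(r₁)` and `y ∈ D_τ(r₂)` — where
`ι₁ : Eⁿ ⊗ B → Eᵏ ⊗ B`, `ι₂ : Eᵐ ⊗ B → Eᵏ ⊗ B` are induced by the two coordinate pull-backs along
`e⁻¹` — lie in `D_τ(r)` (`kron_mem_labelFilD`: `Γ`-invariance from `r(σ)(v ⊗ w) = r₁(σ)v ⊗ r₂(σ)w`,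
`toContinuousRep_apply_kron`; `F` acts through `τ`; filtration degrees add).  For adapted bases
`(d_a)` of `D_τ(r₁)` (weights `h_a`) and `(d'_b)` of `D_τ(r₂)` (weights `h'_b`) the `nm` products
`f_{ab} = ι₁(d_a) ι₂(d'_b)` have labelled periods `piTwist τ f_{ab} = e_*(row_a C₁ ⊗ₖ row_b C₂)`
(`piTwist_kron`), `Cᵢ` the labelled period matrices, which are units of `B ⊗_{F,τ} E` with inverses of
controlled filtration degree (`exists_matrix_mul_piTwist_eq_one`, from the accepted labelled filtered
generation).  Hence, for `v = Σ g_{ab} f_{ab} ∈ Eᵏ ⊗ Fil^i B`, the scalar `1 ⊗ g_{ab}` lies in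
`Fil^{i − h_a − h'_b}(B ⊗_{F,τ} E)`, so `g_{ab} ≠ 0 ⇒ i ≤ h_a + h'_b` (`1 ∉ Fil¹`,
`eq_zero_of_twistScalar_mem_twistFil`).  This gives linear independence of the `f_{ab}` in every label,
so `dim D_{τ'}(r) ≥ nm` for all `τ'`, and Fontaine's count `Σ_{τ'} dim D_{τ'}(r) ≤ nm·[F:P]` makes
`(f_{ab})` a basis of `D_τ(r)` ADAPTED to the filtration with weights `h_a + h'_b`; the accepted
`labelledHodgeTateWeights_eq_map` reads off the three multisets.

## References
* [FontaineAsterisque223III] J.-M. Fontaine, Astérisque 223 (1994), Exp. III §1.5, Prop. 1.5.2,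
  Thm. 1.5.2.
* [BrinonConrad2009] O. Brinon, B. Conrad, *CMI Summer School notes on p-adic Hodge theory* (2009), §6.3.
* [Patrikis2019] S. Patrikis, *Variations on a theorem of Tate*, Mem. AMS 258 (2019), §2.3.1.
* [Wach1996] N. Wach, Bull. SMF 124 (1996), §B.2.3, proof of Prop. 2 (p. 394).
* [Lang1965Algebra] S. Lang, *Algebra*, Ch. XIII §4, Ch. XVI §2.
-/

noncomputable section

open scoped TensorProduct Kronecker
open TensorProduct

namespace Literature.NumberTheory.GaloisRepresentations

namespace PeriodRingData

universe u v v' w w'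

-- Mathlib's own global value of `maxSynthPendingDepth` (see `LabelledWeightsTwist`).
set_option maxSynthPendingDepth 3
set_option synthInstance.maxHeartbeats 200000

/-! ### 1. The ring `Eᵠ ⊗_P B` -/

section Ring

variable {Γ : Type u} [Group Γ] {P : Type v} {F : Type v'} [Field P] [Field F]
  [Algebra P F] {E : Type w} [Field E] [Algebra P E] (𝔅 : PeriodRingData.{u, v, v', w'} Γ P F) {q : ℕ}

/-- The `F`-action on `Eᵠ ⊗_P B` is multiplication by `1 ⊗ f`.
[cite: FontaineAsterisque223III, Exp. III §1.5.4] -/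
theorem baseAct_eq_mul_tmul_pi (f : F) (y : (Fin q → E) ⊗[P] 𝔅.B) :
    𝔅.baseAct E (Fin q → E) f y = y * ((1 : Fin q → E) ⊗ₜ[P] algebraMap F 𝔅.B f) := by
  induction y using TensorProduct.induction_on with
  | zero => rw [map_zero, zero_mul]
  | tmul c b =>
    rw [baseAct_tmul, Algebra.TensorProduct.tmul_mul_tmul, mul_one, Algebra.smul_def, mul_comm]
  | add y z hy hz => rw [map_add, hy, hz, add_mul]

/-- **The filtration `Eᵠ ⊗ Fil^• B` is multiplicative.** [cite: FontaineAsterisque223III, Exp. III §1.5.4] -/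
theorem mul_mem_coeffFilTensor_pi {a i : ℤ} {x y : (Fin q → E) ⊗[P] 𝔅.B}
    (hx : x ∈ 𝔅.coeffFilTensor E (Fin q → E) a) (hy : y ∈ 𝔅.coeffFilTensor E (Fin q → E) i) :
    x * y ∈ 𝔅.coeffFilTensor E (Fin q → E) (a + i) := by
  refine 𝔅.coeffFilTensor_induction (E := E) (M := Fin q → E)
    (C := fun x => x * y ∈ 𝔅.coeffFilTensor E (Fin q → E) (a + i)) ?_ (fun v b hb => ?_)
    (fun x x' hx hx' => ?_) hx
  · rw [zero_mul]; exact zero_mem _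
  · refine 𝔅.coeffFilTensor_induction (E := E) (M := Fin q → E)
      (C := fun y => v ⊗ₜ[P] b * y ∈ 𝔅.coeffFilTensor E (Fin q → E) (a + i)) ?_ (fun w b' hb' => ?_)
      (fun y y' hy hy' => ?_) hy
    · rw [mul_zero]; exact zero_mem _
    · rw [Algebra.TensorProduct.tmul_mul_tmul]
      exact 𝔅.tmul_mem_coeffFilTensor _ (𝔅.mul_mem_fil a i b b' hb hb')
    · rw [mul_add]; exact add_mem hy hy'
  · rw [add_mul]; exact add_mem hx hx'

/-- A coordinate pull-back `ι (v ⊗ b) = g(v) ⊗ b` maps `Eⁿ ⊗ Fil^j B` into `Eᵏ ⊗ Fil^j B`.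
[cite: FontaineAsterisque223III, Exp. III §1.5.4] -/
theorem map_mem_coeffFilTensor_of_tmul {n k : ℕ}
    (ι : (Fin n → E) ⊗[P] 𝔅.B →ₗ[E] (Fin k → E) ⊗[P] 𝔅.B) (g : (Fin n → E) → (Fin k → E))
    (hι : ∀ (v : Fin n → E) (b : 𝔅.B), ι (v ⊗ₜ[P] b) = g v ⊗ₜ[P] b)
    {j : ℤ} {x : (Fin n → E) ⊗[P] 𝔅.B} (hx : x ∈ 𝔅.coeffFilTensor E (Fin n → E) j) :
    ι x ∈ 𝔅.coeffFilTensor E (Fin k → E) j := by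
  refine 𝔅.coeffFilTensor_induction (E := E) (M := Fin n → E)
    (C := fun x => ι x ∈ 𝔅.coeffFilTensor E (Fin k → E) j) ?_ (fun v b hb => ?_)
    (fun y z hy hz => ?_) hx
  · rw [map_zero]; exact zero_mem _
  · rw [hι]; exact 𝔅.tmul_mem_coeffFilTensor _ hb
  · rw [map_add]; exact add_mem hy hz

/-- A coordinate pull-back commutes with the `F`-action. [cite: FontaineAsterisque223III, Exp. III §1.5.4] -/
theorem baseAct_map_of_tmul {n k : ℕ}
    (ι : (Fin n → E) ⊗[P] 𝔅.B →ₗ[E] (Fin k → E) ⊗[P] 𝔅.B) (g : (Fin n → E) → (Fin k → E))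
    (hι : ∀ (v : Fin n → E) (b : 𝔅.B), ι (v ⊗ₜ[P] b) = g v ⊗ₜ[P] b) (f : F)
    (x : (Fin n → E) ⊗[P] 𝔅.B) :
    𝔅.baseAct E (Fin k → E) f (ι x) = ι (𝔅.baseAct E (Fin n → E) f x) := by
  induction x using TensorProduct.induction_on with
  | zero => simp only [map_zero]
  | tmul v b => rw [hι, baseAct_tmul, baseAct_tmul, hι]
  | add y z hy hz => simp only [map_add, hy, hz]

end Ring

/-! ### 2. Scalars of positive filtration degree in `B ⊗_{F,τ} E` vanish; inverse period matrices -/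

section Twist

variable {Γ : Type u} [Group Γ] [TopologicalSpace Γ] {P : Type v} {F : Type v'} [Field P] [Field F]
  [Algebra P F] [TopologicalSpace P] {E : Type w} [Field E] [Algebra P E] [TopologicalSpace E]
  (𝔅 : PeriodRingData.{u, v, v', w'} Γ P F) (τ : F →ₐ[P] E)

omit [TopologicalSpace Γ] [TopologicalSpace P] [TopologicalSpace E] in
/-- **A scalar `1 ⊗ c` lying in `Fil^j(B ⊗_{F,τ} E)` with `j ≥ 1` is zero** (else `1 = (1 ⊗ c⁻¹)(1 ⊗ c)`
would lie in `Fil¹`, against the accepted `one_not_mem_twistFil_one`).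
[cite: FontaineAsterisque223III, Exp. II §1.5.5 and Exp. III §1.5.4] -/
theorem eq_zero_of_twistScalar_mem_twistFil {c : E} {j : ℤ} (hj : 1 ≤ j)
    (hc : 𝔅.twistScalar τ c ∈ LinearMap.range ((𝔅.fil j).subtype.rTensor (TwistCoeff τ))) :
    c = 0 := by
  by_contra hc0
  have h1 : (1 : 𝔅.TwistRing τ) = 𝔅.twistScalar τ c⁻¹ * 𝔅.twistScalar τ c := by
    rw [← twistScalarHom_apply, ← twistScalarHom_apply, ← map_mul, inv_mul_cancel₀ hc0, map_one]
  exact 𝔅.one_not_mem_twistFil_one τ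
    (h1 ▸ 𝔅.twistFil_antitone τ hj (𝔅.twistScalar_mul_mem_twistFil τ c⁻¹ hc))

variable {n : ℕ} (ρ : ContinuousRep Γ E (Fin n → E))

/-- **The labelled period matrix has an inverse of controlled filtration degree.**  With the
hypotheses of the accepted labelled filtered generation (`piTwist_eq_sum_smul_of_mem_coeffFilTensor`)
and an adapted basis `(d_k)_{k<n}` of `D_τ(ρ)` with weights `h_k`, there is a matrix `A` over
`B ⊗_{F,τ} E` with `A · C = 1`, `C = (piTwist τ d_k)_k`, and `A_{ik} ∈ Fil^{−h_k}` (expand the standard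
vectors `e_i ⊗ 1 ∈ Eⁿ ⊗ Fil⁰ B`). [cite: Wach1996, §B.2.3, proof of Prop. 2 (p. 394)] [cite: Patrikis2019, §2.3.1] -/
theorem exists_matrix_mul_piTwist_eq_one [FiniteDimensional P F] [Algebra.IsSeparable P F]
    (hsplit : Fintype.card (F →ₐ[P] E) = Module.finrank P F)
    (hcomp : ∃ (ℓ : ℕ) (𝒷 : Module.Basis (Fin ℓ) 𝔅.B (𝔅.B ⊗[P] (Fin n → E))) (w : Fin ℓ → ℤ),
      (∀ l, 𝒷 l ∈ 𝔅.D (ρ.restrictScalars P)) ∧ (∀ l, 𝒷 l ∈ 𝔅.filTensor (Fin n → E) (w l)) ∧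
      ∀ (j : ℤ) (y : 𝔅.B ⊗[P] (Fin n → E)),
        y ∈ 𝔅.filTensor (Fin n → E) j ↔ ∀ l, 𝒷.repr y l ∈ 𝔅.fil (j - w l))
    (d : Module.Basis (Fin n) E (𝔅.labelD ρ τ.toRingHom)) (h : Fin n → ℤ)
    (hiff : ∀ (i : ℤ) (v : 𝔅.labelD ρ τ.toRingHom),
      (v : (Fin n → E) ⊗[P] 𝔅.B) ∈ 𝔅.labelFilD ρ τ.toRingHom i ↔ ∀ k, d.repr v k ≠ 0 → i ≤ h k) :
    ∃ A : Matrix (Fin n) (Fin n) (𝔅.TwistRing τ),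
      A * (Matrix.of fun k i => 𝔅.piTwist τ n (d k : (Fin n → E) ⊗[P] 𝔅.B) i) = 1 ∧
      ∀ i k, A i k ∈ LinearMap.range ((𝔅.fil (-h k)).subtype.rTensor (TwistCoeff τ)) := by
  classical
  have hstd : ∀ i : Fin n, (Pi.single i (1 : E)) ⊗ₜ[P] (1 : 𝔅.B) ∈ 𝔅.coeffFilTensor E (Fin n → E) 0 :=
    fun i => 𝔅.tmul_mem_coeffFilTensor _ 𝔅.one_mem_fil_zero
  choose A hA hAeq using fun i : Fin n =>
    𝔅.piTwist_eq_sum_smul_of_mem_coeffFilTensor τ ρ hsplit hcomp d h hiff (hstd i)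
  refine ⟨Matrix.of A, ?_, fun i k => by rw [Matrix.of_apply, ← zero_sub]; exact hA i k⟩
  ext i i'
  have h1 := congrFun (hAeq i) i'
  rw [piTwist_single_tmul_one, Finset.sum_apply, Pi.single_apply] at h1
  simp only [Pi.smul_apply, smul_eq_mul] at h1
  simp only [Matrix.mul_apply, Matrix.of_apply, Matrix.one_apply]
  rw [← h1]
  by_cases hii : i = i'
  · subst hii; simp
  · simp [hii, Ne.symm hii]

end Twist

/-! ### 3. Kronecker products inside `Eᵏ ⊗_P B` -/

section Kron

variable {Γ : Type u} [Group Γ] [TopologicalSpace Γ] {P : Type v} {F : Type v'} [Field P] [Field F]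
  [Algebra P F] {E : Type w} [Field E] [Algebra P E] [TopologicalSpace E] [IsTopologicalRing E]
  (𝔅 : PeriodRingData.{u, v, v', w'} Γ P F) {n m k : ℕ} (e : Fin n × Fin m ≃ Fin k)
  (ι₁ : (Fin n → E) ⊗[P] 𝔅.B →ₗ[E] (Fin k → E) ⊗[P] 𝔅.B)
  (hι₁ : ∀ (v : Fin n → E) (b : 𝔅.B), ι₁ (v ⊗ₜ[P] b) = (fun c => v (e.symm c).1) ⊗ₜ[P] b)
  (ι₂ : (Fin m → E) ⊗[P] 𝔅.B →ₗ[E] (Fin k → E) ⊗[P] 𝔅.B)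
  (hι₂ : ∀ (w : Fin m → E) (b : 𝔅.B), ι₂ (w ⊗ₜ[P] b) = (fun c => w (e.symm c).2) ⊗ₜ[P] b)

omit [TopologicalSpace Γ] [TopologicalSpace E] [IsTopologicalRing E] in
include hι₁ hι₂ in
/-- Filtration degrees add under the product: `ι₁(Eⁿ ⊗ Fil^a) · ι₂(Eᵐ ⊗ Fil^b) ⊆ Eᵏ ⊗ Fil^{a+b}`.
[cite: FontaineAsterisque223III, Exp. III §1.5.4] -/
theorem kron_mem_coeffFilTensor {a b : ℤ} {x : (Fin n → E) ⊗[P] 𝔅.B} {y : (Fin m → E) ⊗[P] 𝔅.B}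
    (hx : x ∈ 𝔅.coeffFilTensor E (Fin n → E) a) (hy : y ∈ 𝔅.coeffFilTensor E (Fin m → E) b) :
    ι₁ x * ι₂ y ∈ 𝔅.coeffFilTensor E (Fin k → E) (a + b) :=
  𝔅.mul_mem_coeffFilTensor_pi (𝔅.map_mem_coeffFilTensor_of_tmul ι₁ _ hι₁ hx)
    (𝔅.map_mem_coeffFilTensor_of_tmul ι₂ _ hι₂ hy)

omit [TopologicalSpace Γ] [TopologicalSpace E] [IsTopologicalRing E] in
include hι₂ in
/-- `f · (ι₁ x · ι₂ y) = ι₁ x · ι₂ (f · y)`. [cite: FontaineAsterisque223III, Exp. III §1.5.4] -/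
theorem baseAct_kron (f : F) (x : (Fin n → E) ⊗[P] 𝔅.B) (y : (Fin m → E) ⊗[P] 𝔅.B) :
    𝔅.baseAct E (Fin k → E) f (ι₁ x * ι₂ y) = ι₁ x * ι₂ (𝔅.baseAct E (Fin m → E) f y) := by
  rw [baseAct_eq_mul_tmul_pi, ← 𝔅.baseAct_map_of_tmul ι₂ _ hι₂, baseAct_eq_mul_tmul_pi, mul_assoc]

variable (r₁ : FramedRep Γ E n) (r₂ : FramedRep Γ E m) (r : FramedRep Γ E k)
  (hkron : ∀ σ, (r σ).val = Matrix.reindex e e ((r₁ σ).val ⊗ₖ (r₂ σ).val))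

omit [IsTopologicalRing E] in
include hkron in
/-- **`r(σ)(v ⊗ w) = r₁(σ)v ⊗ r₂(σ)w`** for the Kronecker product in the product basis: on coordinate
functions, `v ⊗ w = (c ↦ v_{e⁻¹(c)₁} · w_{e⁻¹(c)₂})`. [cite: Lang1965Algebra, Ch. XVI §2 (tensor product of matrices)] -/
theorem mulVec_kron (σ : Γ) (v : Fin n → E) (w : Fin m → E) :
    Matrix.mulVec (r σ).val ((fun c => v (e.symm c).1) * fun c => w (e.symm c).2) =
      (fun c => Matrix.mulVec (r₁ σ).val v (e.symm c).1) *
        fun c => Matrix.mulVec (r₂ σ).val w (e.symm c).2 := by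
  rw [hkron σ]
  funext c
  simp only [Pi.mul_apply, Matrix.mulVec, dotProduct, Matrix.reindex_apply, Matrix.submatrix_apply,
    Matrix.kroneckerMap_apply]
  rw [Finset.sum_mul_sum, ← Equiv.sum_comp e, Fintype.sum_prod_type]
  refine Finset.sum_congr rfl fun i _ => Finset.sum_congr rfl fun j _ => ?_
  simp only [Equiv.symm_apply_apply]
  ring

include hkron in
/-- `toContinuousRep` form of `mulVec_kron`. [cite: Lang1965Algebra, Ch. XVI §2 (tensor product of matrices)] -/
theorem toContinuousRep_apply_kron (σ : Γ) (v : Fin n → E) (w : Fin m → E) :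
    FramedRep.toContinuousRep r σ ((fun c => v (e.symm c).1) * fun c => w (e.symm c).2) =
      (fun c => FramedRep.toContinuousRep r₁ σ v (e.symm c).1) *
        fun c => FramedRep.toContinuousRep r₂ σ w (e.symm c).2 := by
  simp only [FramedRep.toContinuousRep_apply_apply]
  exact mulVec_kron e r₁ r₂ r hkron σ v w

include hι₁ hι₂ hkron in
/-- **The diagonal action is multiplicative on Kronecker products**:
`σ · (ι₁ x · ι₂ y) = ι₁(σ · x) · ι₂(σ · y)`. [cite: FontaineAsterisque223III, Exp. III §1.5 (the diagonal action)] -/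
theorem coeffTensorRep_kron (σ : Γ) (x : (Fin n → E) ⊗[P] 𝔅.B) (y : (Fin m → E) ⊗[P] 𝔅.B) :
    𝔅.coeffTensorRep (FramedRep.toContinuousRep r) σ (ι₁ x * ι₂ y) =
      ι₁ (𝔅.coeffTensorRep (FramedRep.toContinuousRep r₁) σ x) *
        ι₂ (𝔅.coeffTensorRep (FramedRep.toContinuousRep r₂) σ y) := by
  induction x using TensorProduct.induction_on with
  | zero => simp only [map_zero, zero_mul]
  | tmul v b =>
    induction y using TensorProduct.induction_on with
    | zero => simp only [map_zero, mul_zero]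
    | tmul w b' =>
      rw [hι₁, hι₂, Algebra.TensorProduct.tmul_mul_tmul, coeffTensorRep_apply_tmul,
        coeffTensorRep_apply_tmul, coeffTensorRep_apply_tmul, hι₁, hι₂,
        Algebra.TensorProduct.tmul_mul_tmul, smul_mul', toContinuousRep_apply_kron e r₁ r₂ r hkron]
    | add y y' hy hy' => simp only [map_add, mul_add, hy, hy']
  | add x x' hx hx' => simp only [map_add, add_mul, hx, hx']

omit [TopologicalSpace Γ] [TopologicalSpace E] [IsTopologicalRing E] in
include hι₁ hι₂ in
/-- **Labelled periods are multiplicative on Kronecker products**: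
`piTwist τ (ι₁ x · ι₂ y)_c = piTwist τ x_{e⁻¹(c)₁} · piTwist τ y_{e⁻¹(c)₂}`.
[cite: Lang1965Algebra, Ch. XVI §2 (maps on generators of a tensor product)] -/
theorem piTwist_kron (τ : F →ₐ[P] E) (x : (Fin n → E) ⊗[P] 𝔅.B) (y : (Fin m → E) ⊗[P] 𝔅.B)
    (c : Fin k) :
    𝔅.piTwist τ k (ι₁ x * ι₂ y) c =
      𝔅.piTwist τ n x (e.symm c).1 * 𝔅.piTwist τ m y (e.symm c).2 := by
  induction x using TensorProduct.induction_on with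
  | zero => simp only [map_zero, zero_mul, Pi.zero_apply]
  | tmul v b =>
    induction y using TensorProduct.induction_on with
    | zero => simp only [map_zero, mul_zero, Pi.zero_apply]
    | tmul w b' =>
      rw [hι₁, hι₂, Algebra.TensorProduct.tmul_mul_tmul, piTwist_tmul, piTwist_tmul, piTwist_tmul,
        Algebra.TensorProduct.tmul_mul_tmul, Pi.mul_apply, map_mul]
    | add y y' hy hy' => simp only [map_add, mul_add, Pi.add_apply, hy, hy']
  | add x x' hx hx' => simp only [map_add, add_mul, Pi.add_apply, hx, hx']

include hι₁ hι₂ hkron in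
/-- **`ι₁(Fil^a D_τ(r₁)) · ι₂(Fil^b D_τ(r₂)) ⊆ Fil^{a+b} D_τ(r)`.**
[cite: FontaineAsterisque223III, Exp. III §1.5 and Prop. 1.5.2] [cite: Patrikis2019, §2.3.1] -/
theorem kron_mem_labelFilD (τ : F →+* E) {a b : ℤ} {x : (Fin n → E) ⊗[P] 𝔅.B}
    {y : (Fin m → E) ⊗[P] 𝔅.B} (hx : x ∈ 𝔅.labelFilD (FramedRep.toContinuousRep r₁) τ a)
    (hy : y ∈ 𝔅.labelFilD (FramedRep.toContinuousRep r₂) τ b) :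
    ι₁ x * ι₂ y ∈ 𝔅.labelFilD (FramedRep.toContinuousRep r) τ (a + b) := by
  obtain ⟨hxD, hxa⟩ := Submodule.mem_inf.1 hx
  obtain ⟨hyD, hyb⟩ := Submodule.mem_inf.1 hy
  refine Submodule.mem_inf.2 ⟨⟨?_, fun f => ?_⟩, 𝔅.kron_mem_coeffFilTensor e ι₁ hι₁ ι₂ hι₂ hxa hyb⟩
  · rw [mem_coeffD_iff]
    intro σ
    rw [𝔅.coeffTensorRep_kron e ι₁ hι₁ ι₂ hι₂ r₁ r₂ r hkron,
      (𝔅.mem_coeffD_iff _ _).1 (𝔅.labelD_le_coeffD _ _ hxD) σ,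
      (𝔅.mem_coeffD_iff _ _).1 (𝔅.labelD_le_coeffD _ _ hyD) σ]
  · rw [𝔅.baseAct_kron e ι₁ ι₂ hι₂, ((𝔅.mem_labelD_iff _ _ _).1 hyD).2 f, map_smul, mul_smul_comm]

end Kron

/-! ### 4. The theorem -/

section Main

variable {Γ : Type u} [Group Γ] [TopologicalSpace Γ] {P : Type v} {F : Type v'} [Field P] [Field F]
  [Algebra P F] [TopologicalSpace P] {E : Type w} [Field E] [Algebra P E] [TopologicalSpace E]
  [IsTopologicalRing E] (𝔅 : PeriodRingData.{u, v, v', w'} Γ P F)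

/-- The multiset of pairwise sums. [cite: Lang1965Algebra, Ch. XVI §2] -/
theorem map_univ_add_eq_bind {n m k : ℕ} (e : Fin n × Fin m ≃ Fin k) (h₁ : Fin n → ℤ)
    (h₂ : Fin m → ℤ) :
    (Finset.univ : Finset (Fin k)).val.map (fun c => h₁ (e.symm c).1 + h₂ (e.symm c).2) =
      ((Finset.univ : Finset (Fin n)).val.map h₁).bind fun a =>
        ((Finset.univ : Finset (Fin m)).val.map h₂).map fun b => a + b := by
  rw [Multiset.bind_map, ← Finset.map_univ_equiv e, Finset.map_val, Multiset.map_map,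
    ← Finset.univ_product_univ, Finset.product_val]
  simp only [Function.comp_def, Equiv.coe_toEmbedding, Equiv.symm_apply_apply, Multiset.map_map,
    SProd.sprod, Multiset.product, Multiset.map_bind]

/-- **Labelled Hodge–Tate weights of a Kronecker product are the pairwise sums:
`HT_τ(r) = {a + b : a ∈ HT_τ(r₁), b ∈ HT_τ(r₂)}`** for `r = e_*(r₁ ⊗ₖ r₂)`, `r₁`, `r₂` with
`B`-admissible `P`-restrictions satisfying the filtered comparison, `B` a field and `E/P` finite
containing the embeddings of `F`.
[cite: FontaineAsterisque223III, Exp. III §1.5, Prop. 1.5.2 and Thm. 1.5.2] [cite: BrinonConrad2009, §6.3] [cite: Patrikis2019, §2.3.1] -/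
theorem labelledHodgeTateWeights_kron (hB : IsField 𝔅.B) [FiniteDimensional P F]
    [Algebra.IsSeparable P F] [FiniteDimensional P E]
    (hsplit : Fintype.card (F →ₐ[P] E) = Module.finrank P F) {n m k : ℕ}
    (e : Fin n × Fin m ≃ Fin k) (r₁ : FramedRep Γ E n) (r₂ : FramedRep Γ E m) (r : FramedRep Γ E k)
    (hkron : ∀ σ, (r σ).val = Matrix.reindex e e ((r₁ σ).val ⊗ₖ (r₂ σ).val))
    (hadm₁ : 𝔅.IsAdmissible ((FramedRep.toContinuousRep r₁).restrictScalars P))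
    (hadm₂ : 𝔅.IsAdmissible ((FramedRep.toContinuousRep r₂).restrictScalars P))
    (hcomp₁ : ∃ (ℓ : ℕ) (𝒷 : Module.Basis (Fin ℓ) 𝔅.B (𝔅.B ⊗[P] (Fin n → E))) (w : Fin ℓ → ℤ),
      (∀ l, 𝒷 l ∈ 𝔅.D ((FramedRep.toContinuousRep r₁).restrictScalars P)) ∧
      (∀ l, 𝒷 l ∈ 𝔅.filTensor (Fin n → E) (w l)) ∧
      ∀ (j : ℤ) (y : 𝔅.B ⊗[P] (Fin n → E)),
        y ∈ 𝔅.filTensor (Fin n → E) j ↔ ∀ l, 𝒷.repr y l ∈ 𝔅.fil (j - w l))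
    (hcomp₂ : ∃ (ℓ : ℕ) (𝒷 : Module.Basis (Fin ℓ) 𝔅.B (𝔅.B ⊗[P] (Fin m → E))) (w : Fin ℓ → ℤ),
      (∀ l, 𝒷 l ∈ 𝔅.D ((FramedRep.toContinuousRep r₂).restrictScalars P)) ∧
      (∀ l, 𝒷 l ∈ 𝔅.filTensor (Fin m → E) (w l)) ∧
      ∀ (j : ℤ) (y : 𝔅.B ⊗[P] (Fin m → E)),
        y ∈ 𝔅.filTensor (Fin m → E) j ↔ ∀ l, 𝒷.repr y l ∈ 𝔅.fil (j - w l))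
    (τ : F →ₐ[P] E) :
    𝔅.labelledHodgeTateWeights (FramedRep.toContinuousRep r) τ.toRingHom =
      (𝔅.labelledHodgeTateWeights (FramedRep.toContinuousRep r₁) τ.toRingHom).bind fun a =>
        (𝔅.labelledHodgeTateWeights (FramedRep.toContinuousRep r₂) τ.toRingHom).map
          fun b => a + b := by
  classical
  -- the coordinate pull-backs
  let ι₁ : (Fin n → E) ⊗[P] 𝔅.B →ₗ[E] (Fin k → E) ⊗[P] 𝔅.B :=
    TensorProduct.AlgebraTensorModule.map (LinearMap.funLeft E E fun c => (e.symm c).1) LinearMap.id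
  have hι₁ : ∀ (v : Fin n → E) (b : 𝔅.B), ι₁ (v ⊗ₜ[P] b) = (fun c => v (e.symm c).1) ⊗ₜ[P] b :=
    fun v b => rfl
  let ι₂ : (Fin m → E) ⊗[P] 𝔅.B →ₗ[E] (Fin k → E) ⊗[P] 𝔅.B :=
    TensorProduct.AlgebraTensorModule.map (LinearMap.funLeft E E fun c => (e.symm c).2) LinearMap.id
  have hι₂ : ∀ (w : Fin m → E) (b : 𝔅.B), ι₂ (w ⊗ₜ[P] b) = (fun c => w (e.symm c).2) ⊗ₜ[P] b :=
    fun w b => rfl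
  have hk : n * m = k := by
    have := Fintype.card_congr e
    rwa [Fintype.card_prod, Fintype.card_fin, Fintype.card_fin, Fintype.card_fin] at this
  -- adapted bases of every `D_{τ'}(r₁)`, `D_{τ'}(r₂)`
  have hbasis₁ : ∀ τ' : F →ₐ[P] E,
      ∃ (d : Module.Basis (Fin n) E (𝔅.labelD (FramedRep.toContinuousRep r₁) τ'.toRingHom))
        (h : Fin n → ℤ),
        (∀ a, (d a : (Fin n → E) ⊗[P] 𝔅.B) ∈
          𝔅.labelFilD (FramedRep.toContinuousRep r₁) τ'.toRingHom (h a)) ∧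
        ∀ (i : ℤ) (v : 𝔅.labelD (FramedRep.toContinuousRep r₁) τ'.toRingHom),
          (v : (Fin n → E) ⊗[P] 𝔅.B) ∈ 𝔅.labelFilD (FramedRep.toContinuousRep r₁) τ'.toRingHom i ↔
            ∀ a, d.repr v a ≠ 0 → i ≤ h a := fun τ' => by
    obtain ⟨hfinτ, hrank⟩ := 𝔅.finrank_labelD_eq_of_isAdmissible hB hsplit r₁ hadm₁ τ'
    haveI := hfinτ
    obtain ⟨m', d, h, hdh, hiff⟩ :=
      𝔅.exists_basis_labelD_adapted (FramedRep.toContinuousRep r₁) τ'.toRingHom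
    have hm : m' = n := by rw [← hrank, Module.finrank_eq_card_basis d, Fintype.card_fin]
    subst hm
    exact ⟨d, h, hdh, hiff⟩
  have hbasis₂ : ∀ τ' : F →ₐ[P] E,
      ∃ (d : Module.Basis (Fin m) E (𝔅.labelD (FramedRep.toContinuousRep r₂) τ'.toRingHom))
        (h : Fin m → ℤ),
        (∀ a, (d a : (Fin m → E) ⊗[P] 𝔅.B) ∈
          𝔅.labelFilD (FramedRep.toContinuousRep r₂) τ'.toRingHom (h a)) ∧
        ∀ (i : ℤ) (v : 𝔅.labelD (FramedRep.toContinuousRep r₂) τ'.toRingHom),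
          (v : (Fin m → E) ⊗[P] 𝔅.B) ∈ 𝔅.labelFilD (FramedRep.toContinuousRep r₂) τ'.toRingHom i ↔
            ∀ a, d.repr v a ≠ 0 → i ≤ h a := fun τ' => by
    obtain ⟨hfinτ, hrank⟩ := 𝔅.finrank_labelD_eq_of_isAdmissible hB hsplit r₂ hadm₂ τ'
    haveI := hfinτ
    obtain ⟨m', d, h, hdh, hiff⟩ :=
      𝔅.exists_basis_labelD_adapted (FramedRep.toContinuousRep r₂) τ'.toRingHom
    have hm : m' = m := by rw [← hrank, Module.finrank_eq_card_basis d, Fintype.card_fin]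
    subst hm
    exact ⟨d, h, hdh, hiff⟩
  -- KEY: filtration degrees of the coordinates of `Σ g_{ab} ι₁(d_a) ι₂(d'_b)`
  have key : ∀ (τ' : F →ₐ[P] E)
      (d₁ : Module.Basis (Fin n) E (𝔅.labelD (FramedRep.toContinuousRep r₁) τ'.toRingHom))
      (h₁ : Fin n → ℤ)
      (hiff₁ : ∀ (i : ℤ) (v : 𝔅.labelD (FramedRep.toContinuousRep r₁) τ'.toRingHom),
        (v : (Fin n → E) ⊗[P] 𝔅.B) ∈ 𝔅.labelFilD (FramedRep.toContinuousRep r₁) τ'.toRingHom i ↔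
          ∀ a, d₁.repr v a ≠ 0 → i ≤ h₁ a)
      (d₂ : Module.Basis (Fin m) E (𝔅.labelD (FramedRep.toContinuousRep r₂) τ'.toRingHom))
      (h₂ : Fin m → ℤ)
      (hiff₂ : ∀ (i : ℤ) (v : 𝔅.labelD (FramedRep.toContinuousRep r₂) τ'.toRingHom),
        (v : (Fin m → E) ⊗[P] 𝔅.B) ∈ 𝔅.labelFilD (FramedRep.toContinuousRep r₂) τ'.toRingHom i ↔
          ∀ a, d₂.repr v a ≠ 0 → i ≤ h₂ a)
      (g : Fin n × Fin m → E) (i : ℤ),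
      (∑ p, g p • (ι₁ (d₁ p.1 : (Fin n → E) ⊗[P] 𝔅.B) * ι₂ (d₂ p.2 : (Fin m → E) ⊗[P] 𝔅.B))) ∈
          𝔅.coeffFilTensor E (Fin k → E) i →
        ∀ p, g p ≠ 0 → i ≤ h₁ p.1 + h₂ p.2 := by
    intro τ' d₁ h₁ hiff₁ d₂ h₂ hiff₂ g i hmem p hp
    by_contra hlt
    obtain ⟨A₁, hA₁, hA₁mem⟩ :=
      𝔅.exists_matrix_mul_piTwist_eq_one τ' (FramedRep.toContinuousRep r₁) hsplit hcomp₁ d₁ h₁ hiff₁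
    obtain ⟨A₂, hA₂, hA₂mem⟩ :=
      𝔅.exists_matrix_mul_piTwist_eq_one τ' (FramedRep.toContinuousRep r₂) hsplit hcomp₂ d₂ h₂ hiff₂
    set C₁ : Matrix (Fin n) (Fin n) (𝔅.TwistRing τ') :=
      Matrix.of fun a i' => 𝔅.piTwist τ' n (d₁ a : (Fin n → E) ⊗[P] 𝔅.B) i' with hC₁
    set C₂ : Matrix (Fin m) (Fin m) (𝔅.TwistRing τ') :=
      Matrix.of fun b j' => 𝔅.piTwist τ' m (d₂ b : (Fin m → E) ⊗[P] 𝔅.B) j' with hC₂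
    -- the labelled periods of the combination
    set γ : Fin n × Fin m → 𝔅.TwistRing τ' := fun p => 𝔅.twistScalar τ' (g p) with hγ
    set π : Fin n × Fin m → 𝔅.TwistRing τ' := fun q =>
      𝔅.piTwist τ' k (∑ p, g p • (ι₁ (d₁ p.1 : (Fin n → E) ⊗[P] 𝔅.B) *
        ι₂ (d₂ p.2 : (Fin m → E) ⊗[P] 𝔅.B))) (e q) with hπ
    have hπmem : ∀ q, π q ∈ LinearMap.range ((𝔅.fil i).subtype.rTensor (TwistCoeff τ')) :=
      fun q => 𝔅.piTwist_apply_mem_twistFil τ' hmem (e q)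
    have hvec : Matrix.vecMul γ (C₁ ⊗ₖ C₂) = π := by
      funext q
      rw [hπ]
      simp only [Matrix.vecMul, dotProduct, Matrix.kroneckerMap_apply, hC₁, hC₂, Matrix.of_apply, hγ]
      rw [map_sum, Finset.sum_apply]
      refine Finset.sum_congr rfl fun p _ => ?_
      rw [piTwist_smul, Pi.smul_apply, smul_eq_mul, 𝔅.piTwist_kron e ι₁ hι₁ ι₂ hι₂,
        Equiv.symm_apply_apply]
    have hinv : (C₁ ⊗ₖ C₂) * (A₁ ⊗ₖ A₂) = 1 := by
      rw [← Matrix.mul_kronecker_mul, mul_eq_one_comm.1 hA₁, mul_eq_one_comm.1 hA₂,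
        Matrix.one_kronecker_one]
    have hγeq : γ = Matrix.vecMul π (A₁ ⊗ₖ A₂) := by
      rw [← hvec, Matrix.vecMul_vecMul, hinv, Matrix.vecMul_one]
    have hγmem : γ p ∈ LinearMap.range
        ((𝔅.fil (i + (-h₁ p.1 + -h₂ p.2))).subtype.rTensor (TwistCoeff τ')) := by
      rw [hγeq]
      simp only [Matrix.vecMul, dotProduct, Matrix.kroneckerMap_apply]
      exact Submodule.sum_mem _ fun q _ =>
        𝔅.mul_mem_twistFil τ' (hπmem q) (𝔅.mul_mem_twistFil τ' (hA₁mem q.1 p.1) (hA₂mem q.2 p.2))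
    exact hp (𝔅.eq_zero_of_twistScalar_mem_twistFil τ' (by omega) hγmem)
  -- Fontaine's count for `r`: `Σ_{τ'} dim D_{τ'}(r) ≤ k · [F:P]`
  haveI : Module.Finite F (𝔅.D ((FramedRep.toContinuousRep r).restrictScalars P)) :=
    Module.rank_lt_aleph0_iff.1 ((𝔅.rank_D_le _).trans_lt Cardinal.natCast_lt_aleph0)
  have hD : Module.finrank F (𝔅.D ((FramedRep.toContinuousRep r).restrictScalars P)) ≤
      Module.finrank P (Fin k → E) := 𝔅.finrank_D_le_holds _
  obtain ⟨hfin, hle⟩ := 𝔅.finite_coeffD_and_finrank_le (FramedRep.toContinuousRep r) hD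
  haveI := hfin
  haveI : ∀ τ' : F →ₐ[P] E,
      FiniteDimensional E (𝔅.labelD (FramedRep.toContinuousRep r) τ'.toRingHom) := fun τ' =>
    Submodule.finiteDimensional_of_le (𝔅.labelD_le_coeffD (FramedRep.toContinuousRep r) _)
  -- the products of adapted bases are linearly independent in every label
  have hli : ∀ (τ' : F →ₐ[P] E)
      (d₁ : Module.Basis (Fin n) E (𝔅.labelD (FramedRep.toContinuousRep r₁) τ'.toRingHom))
      (h₁ : Fin n → ℤ)
      (hdh₁ : ∀ a, (d₁ a : (Fin n → E) ⊗[P] 𝔅.B) ∈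
        𝔅.labelFilD (FramedRep.toContinuousRep r₁) τ'.toRingHom (h₁ a))
      (hiff₁ : ∀ (i : ℤ) (v : 𝔅.labelD (FramedRep.toContinuousRep r₁) τ'.toRingHom),
        (v : (Fin n → E) ⊗[P] 𝔅.B) ∈ 𝔅.labelFilD (FramedRep.toContinuousRep r₁) τ'.toRingHom i ↔
          ∀ a, d₁.repr v a ≠ 0 → i ≤ h₁ a)
      (d₂ : Module.Basis (Fin m) E (𝔅.labelD (FramedRep.toContinuousRep r₂) τ'.toRingHom))
      (h₂ : Fin m → ℤ)
      (hdh₂ : ∀ a, (d₂ a : (Fin m → E) ⊗[P] 𝔅.B) ∈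
        𝔅.labelFilD (FramedRep.toContinuousRep r₂) τ'.toRingHom (h₂ a))
      (hiff₂ : ∀ (i : ℤ) (v : 𝔅.labelD (FramedRep.toContinuousRep r₂) τ'.toRingHom),
        (v : (Fin m → E) ⊗[P] 𝔅.B) ∈ 𝔅.labelFilD (FramedRep.toContinuousRep r₂) τ'.toRingHom i ↔
          ∀ a, d₂.repr v a ≠ 0 → i ≤ h₂ a),
      LinearIndependent E (fun p : Fin n × Fin m =>
        (⟨ι₁ (d₁ p.1 : (Fin n → E) ⊗[P] 𝔅.B) * ι₂ (d₂ p.2 : (Fin m → E) ⊗[P] 𝔅.B),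
          𝔅.labelFilD_le _ _ _ (𝔅.kron_mem_labelFilD e ι₁ hι₁ ι₂ hι₂ r₁ r₂ r hkron τ'.toRingHom
            (hdh₁ p.1) (hdh₂ p.2))⟩ :
          𝔅.labelD (FramedRep.toContinuousRep r) τ'.toRingHom)) := by
    intro τ' d₁ h₁ hdh₁ hiff₁ d₂ h₂ hdh₂ hiff₂
    refine Fintype.linearIndependent_iff.2 fun g hg p => ?_
    by_contra hp
    have hsum : (∑ q, g q • (ι₁ (d₁ q.1 : (Fin n → E) ⊗[P] 𝔅.B) *
        ι₂ (d₂ q.2 : (Fin m → E) ⊗[P] 𝔅.B))) = 0 := by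
      have := congrArg Subtype.val hg
      simpa only [Submodule.coe_sum, Submodule.coe_smul, Submodule.coe_zero] using this
    have hmem : (∑ q, g q • (ι₁ (d₁ q.1 : (Fin n → E) ⊗[P] 𝔅.B) *
        ι₂ (d₂ q.2 : (Fin m → E) ⊗[P] 𝔅.B))) ∈
        𝔅.coeffFilTensor E (Fin k → E) (h₁ p.1 + h₂ p.2 + 1) := by
      rw [hsum]; exact zero_mem _
    have := key τ' d₁ h₁ hiff₁ d₂ h₂ hiff₂ g _ hmem p hp
    omega
  -- hence `dim_E D_{τ'}(r) = k` for every label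
  have hsumdim : Module.finrank E (𝔅.coeffD (FramedRep.toContinuousRep r)) =
      ∑ τ' : F →ₐ[P] E, Module.finrank E (𝔅.labelD (FramedRep.toContinuousRep r) τ'.toRingHom) := by
    rw [CoeffEigen.finrank_eq_sum_finrank_eigenSub (U := 𝔅.coeffD (FramedRep.toContinuousRep r))
      (𝔅.coeffDAct (FramedRep.toContinuousRep r)) hsplit]
    exact Finset.sum_congr rfl fun τ' _ => 𝔅.finrank_eigenSub_coeffDAct (FramedRep.toContinuousRep r) τ'
  have hge : ∀ τ' : F →ₐ[P] E,
      k ≤ Module.finrank E (𝔅.labelD (FramedRep.toContinuousRep r) τ'.toRingHom) := fun τ' => by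
    obtain ⟨d₁, h₁, hdh₁, hiff₁⟩ := hbasis₁ τ'
    obtain ⟨d₂, h₂, hdh₂, hiff₂⟩ := hbasis₂ τ'
    have h := (hli τ' d₁ h₁ hdh₁ hiff₁ d₂ h₂ hdh₂ hiff₂).fintype_card_le_finrank
    rwa [Fintype.card_prod, Fintype.card_fin, Fintype.card_fin, hk] at h
  have hdim : Module.finrank E (𝔅.labelD (FramedRep.toContinuousRep r) τ.toRingHom) = k := by
    refine CoeffEigen.eq_of_sum_le_of_le
      (d := fun τ' : F →ₐ[P] E =>
        Module.finrank E (𝔅.labelD (FramedRep.toContinuousRep r) τ'.toRingHom)) ?_ hge τ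
    rw [← hsumdim, hsplit]
    exact hle
  -- the adapted basis of `D_τ(r)`
  obtain ⟨d₁, h₁, hdh₁, hiff₁⟩ := hbasis₁ τ
  obtain ⟨d₂, h₂, hdh₂, hiff₂⟩ := hbasis₂ τ
  have hcard : Fintype.card (Fin n × Fin m) =
      Module.finrank E (𝔅.labelD (FramedRep.toContinuousRep r) τ.toRingHom) := by
    rw [Fintype.card_prod, Fintype.card_fin, Fintype.card_fin, hk, hdim]
  set f := basisOfLinearIndependentOfCardEqFinrank' _
    (hli τ d₁ h₁ hdh₁ hiff₁ d₂ h₂ hdh₂ hiff₂) hcard with hf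
  have hfapply : ∀ p, (f p : (Fin k → E) ⊗[P] 𝔅.B) =
      ι₁ (d₁ p.1 : (Fin n → E) ⊗[P] 𝔅.B) * ι₂ (d₂ p.2 : (Fin m → E) ⊗[P] 𝔅.B) := fun p => by
    rw [hf, coe_basisOfLinearIndependentOfCardEqFinrank']
  set d := f.reindex e with hd
  have hH : ∀ (i : ℤ) (v : 𝔅.labelD (FramedRep.toContinuousRep r) τ.toRingHom),
      (v : (Fin k → E) ⊗[P] 𝔅.B) ∈ 𝔅.labelFilD (FramedRep.toContinuousRep r) τ.toRingHom i ↔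
        ∀ c, d.repr v c ≠ 0 → i ≤ h₁ (e.symm c).1 + h₂ (e.symm c).2 := by
    intro i v
    constructor
    · intro hv c hc
      rw [hd, Module.Basis.repr_reindex_apply] at hc
      have hsum : (v : (Fin k → E) ⊗[P] 𝔅.B) =
          ∑ p, f.repr v p • (ι₁ (d₁ p.1 : (Fin n → E) ⊗[P] 𝔅.B) *
            ι₂ (d₂ p.2 : (Fin m → E) ⊗[P] 𝔅.B)) := by
        conv_lhs => rw [← f.sum_repr v]
        rw [Submodule.coe_sum]
        exact Finset.sum_congr rfl fun p _ => by rw [Submodule.coe_smul, hfapply]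
      exact key τ d₁ h₁ hiff₁ d₂ h₂ hiff₂ (fun p => f.repr v p) i
        (hsum ▸ (Submodule.mem_inf.1 hv).2) (e.symm c) hc
    · intro hc
      rw [← d.sum_repr v, Submodule.coe_sum]
      refine Submodule.sum_mem _ fun c _ => ?_
      rw [Submodule.coe_smul]
      by_cases h0 : d.repr v c = 0
      · rw [h0, zero_smul]; exact zero_mem _
      · refine Submodule.smul_mem _ _ (𝔅.labelFilD_antitone _ _ (hc c h0) ?_)
        rw [hd, Module.Basis.reindex_apply, hfapply]
        exact 𝔅.kron_mem_labelFilD e ι₁ hι₁ ι₂ hι₂ r₁ r₂ r hkron τ.toRingHom (hdh₁ _) (hdh₂ _)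
  rw [labelledHodgeTateWeights_eq_map d _ hH, labelledHodgeTateWeights_eq_map d₁ h₁ hiff₁,
    labelledHodgeTateWeights_eq_map d₂ h₂ hiff₂]
  exact map_univ_add_eq_bind e h₁ h₂

end Main

end PeriodRingData

end Literature.NumberTheory.GaloisRepresentations

end
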